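import Summits.ResolutionOfSingularities.ResolutionOfSingularities.Theorems.HilbertSamuelEliminationSigmaMaxModificationsCorridor3WLadderStrataBirthsTopDictionary
import HarnessLib

/-!
# [OURS · L1 W4.2] `Corridor3WLadderStrataBirthsMovingDefs` — the MOVING half of row (b-end), part 1/2: DEFINITIONS
# (depth ≥ 2 at the marked point, the sandwich of a moving birth, the rows «no late depth jumps» and «depth discipline»)

Part 1/2 (definitions + the sandwich lemmas) of res-type-040's W4.2 DEAL D13 object; part 2/2 `…Corridor3WLadderStrataBirthsMoving`
carries the PROVED reduction «late moving births need late ruled rebirths» and D13's target by name. The gate caps Theorems files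
with proofs at 400 lines, hence the split (same namespace `…Theorems.SigmaMaxModificationsCorridor3.Moving`). The common module
docstring (parts 1–2) follows.

## Common module docstring — «LATE MOVING BIRTHS NEED LATE RULED REBIRTHS» (W4.2 DEAL D13, a PROVED reduction)

Crux chain w42 (`SigmaMaxModifications`, stmt-ResolutionOfSingularities-18506; conjunct `SigmaMaxModificationsCorridor3`,
stmt-ResolutionOfSingularities-19249, skeleton `w_ladder` v6/v7), res-L1-w42-plan-1 RULINGS v3.12-2 (J3) / v3.12-3 (O) DEAL D13
«(b-end)₃ MOVING / SURFACE-CENTRE CASE» → res-type-040 (gen 18). OURS (cell res-hironaka, slot W4.2); NOT statements of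
H. Hironaka's manuscript [Hironaka2017] nor of [CossartJannsenSaito2020]; AI-drafted, weaker than expert review. Helper file
`--supports stmt-ResolutionOfSingularities-19249` (counted 0). Every `theorem` is PROVED; the open content sits in ONE
`def … : Prop` row (`StrataCycleEndNoDepthJumps`, §2) — the second `def … : Prop` (`StrataDepthDiscipline`) is standard blow-up
geometry typed as a binder.

## The object

res-type-067's split of stub-4's cycle-end births row (b-end) `StrataCycleEndBirthsSettle` (p504439/…StrataBirths) into «no late
FIBRE births» ∧ «no late MOVING births» (`…StrataBirthsTopDictionary`, p513551, join `strataCycleEndBirthsSettle_of_noFibre_noMoving`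
PROVED) left the MOVING row `StrataCycleEndNoMovingBirths p 3 (QNe Q) (3 ≤ ē)` as D13: eventually, at blown-up CYCLE-END steps of a
moving never-isolated `ē ≥ 3` chain, no irreducible component `Z' ∋ x_{n+1}` of `X_{n+1}(ν)` is NEWBORN with a positive-dimensional
image (a curve `Z'` over a non-component curve `Γ ∋ x_n` inside the surface being blown up). plan-1 named the danger: THREAD
HOPPING — a local fact at the generic point `ζ_Γ` kills one thread, label bookkeeping alone restates the row.

## What is proved (namespace `…Theorems.SigmaMaxModificationsCorridor3.Moving`)

* §1 `HasSandwichAt s Z` («`Z` has depth `≥ 2` at the marked point»: an irreducible closed `B` with `{x_n} ⊊ B ⊊ Z`) and the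
  SANDWICH `IsMovingBirthAt.exists_host`: under the cycle invariant, at a cycle-end step a moving birth `Z'` has
  `B = closure f(Z')` inside ONE label-`j` component `S ∋ x_n` of the centre `Y_n^{(j)}` (`j` the treated label; births lie over
  the centre, stub-4 p504439; `support_eq_part_of_next_none`, p503069), with `{x_n} ⊊ B ⊊ S` — the host is a SURFACE of label
  `treatedLabel`. Corollary `not_isMovingBirthAt_of_forall_not_hasSandwichAt`: NO MOVING BIRTH when the centre's components
  through `x_n` are CURVES (plan-1 (J1)'s second dichotomy lemma; nothing geometric assumed).
* §3 LABEL ESCAPE `treatedLabel_unbounded_of_centreIO_of_replaySettle`: under (c-geo) `StrataLineageInCentreIO` and (c-rep)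
  `StrataReplayBlowupsSettle` the treated label is UNBOUNDED along a moving never-isolated chain (stub-4's Kőnig-on-label-`j`
  argument of p503885 re-run with an arbitrary bound) — so late moving births are hosted by surfaces of LATE labels, i.e. by
  lineages BORN THROUGH THE CHAIN POINTS at late stages.
* §4 THE REDUCTION `strataCycleEndNoMovingBirths_of_centreIO` (any `N`, `Q`, `G`, under `QNe Q`):
  (c-geo) ∧ (c-rep) ∧ «no late fibre births» (`StrataCycleEndNoFibreBirths`, res-type-067 / D9) ∧ «no late depth jumps»
  (`StrataCycleEndNoDepthJumps`, §2) ∧ depth discipline (`StrataDepthDiscipline`, §2) ⇒ `StrataCycleEndNoMovingBirths`. Proof: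
  no component of a late label through a chain point has depth `≥ 2` (induction on the stage: a dominating one would need a late
  depth JUMP inside the centre at a blown-up cycle-end step — discipline (b), (c-rep), (b-jump); a newborn one is born at a
  blown-up cycle end (`isBlownUp_of_birth`, (c-rep)) as a fibre birth (excluded) or a moving birth, of depth `≤ 1` by discipline
  (a)); but the host of a late moving birth is exactly such a component. With (c-geo) discharged by the H-layer
  (`strataLineageInCentreIO_of_localChains`, p513904): `strataCycleEndNoMovingBirths_of_local`, D13's target BY NAME
  `strataCycleEndNoMovingBirths_three_of_local`, and the corollaries `strataCycleEndBirthsSettle_three_of_local` ((b-end)₃, via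
  067's join), `strataBirthsSettle_three_of_local` ((b)₃, via stub-4's `strataBirthsSettle_of_replaySettle_of_cycleEnd`) and
  `wtopEvNonIsoM_qNe_of_local_births` (res-type-012's `WtopEvNonIsoM p (QNe Q)` via `wtopEvNonIsoM_of_localChains`).

## What is NOT proved, and why the reduction is honest

`StrataCycleEndNoDepthJumps` (§2, OPEN) is the RULED phenomenon of res-type-067's `NoRuledBirth3` / `RuledBirthDatumD` read for a
DOMINATING component: a curve component `Z ∋ x_n` of the centre REBORN through `x_{n+1}` as a surface `Z' ⊆ π⁻¹(Z)` contains the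
whole fibre `ℙ(Dir_{x_n}/T_{x_n}Z) ≅ ℙ¹` over `x_n`, wholly near. So BOTH halves of (b-end)₃ now hang on the ONE graded claim «at late
curve-centre cycle ends the fibre `ℙ¹` over the chain point is not wholly near» (newborn = fibre birth, dominating = ruled
rebirth), plus (c-rep)₃ and the dischargeable discipline; thread hopping is converted into «ever-new surfaces need ever-new
births, and a surface lineage is born as a CURVE (moving birth) and must JUMP». `StrataDepthDiscipline` is believed (and consumed)
at level `N = 3` only.

References: CJS LNM 2270 Rem. 6.29 (1) pp. 91–92, p. 105, p. 107, Def. 3.1, Thm. 3.14, Lemma 6.30 [CossartJannsenSaito2020];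
Görtz–Wedhorn I Prop. 13.91 (3) [GortzWedhorn2020]; tree `…WLadderStrataLineages` (p500484), `…StrataLabels` (p503069),
`…StrataCentre` (p503885), `…StrataScope` (p504439), `…StrataBirths`, `…StrataBirthsTopDictionary` (p513551), `…LocalChainsDefs`
(p513323), `…LocalChains` (p513904), `…MovingIsoDefs` (p500943); HOME STATUS res-L1-w42-plan-1 RULINGS v3.12-2 (J)/(J3) 08:17:15Z,
v3.12-3 (N)–(S) 08:32:59Z; res-type-040 CUT 08:58:02Z.
-/

noncomputable section

set_option linter.dupNamespace false

open CategoryTheory AlgebraicGeometry TopologicalSpace Topology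
open Summit.ResolutionOfSingularities.ResolutionOfSingularities.Theorems.CampaignW42
open Literature.AlgebraicGeometry.Resolution Literature.RingTheory.HilbertSamuel
open Literature.AlgebraicGeometry.CossartJannsenSaito2020
open Summit.ResolutionOfSingularities.ResolutionOfSingularities.Theorems.SigmaMaxModificationsCorridor3

namespace Summit.ResolutionOfSingularities.ResolutionOfSingularities.Theorems.SigmaMaxModificationsCorridor3.Moving

universe u

variable {R : ∀ S : Scheme.{u}, CentreSeq S → Prop} {N : ℕ} {ν : ℕ → ℕ}

/-! ## §1. Depth ≥ 2 at the marked point («surface-like»), and the SANDWICH of a moving birth -/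

/-- [OURS · L1 W4.2] **`Z` HAS DEPTH ≥ 2 AT THE MARKED POINT** («a sandwich»): there is an irreducible closed subset `B` with
`{x_n} ⊊ B ⊊ Z`, `x_n ∈ B` — the order-theoretic shadow of «`Z` is (at least) a SURFACE through `x_n`» (a curve through a
closed point has no such `B`). OURS bookkeeping; NOT a statement of the manuscript. [folklore] -/
def HasSandwichAt (s : MarkedStage.{u}) (Z : Set s.W) : Prop :=
  ∃ B : Set s.W, IsIrreducible B ∧ IsClosed B ∧ s.pt ∈ B ∧ B ⊆ Z ∧ B ≠ {s.pt} ∧ B ≠ Z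

/-- **THE SANDWICH OF A MOVING BIRTH AT A BLOWN-UP CYCLE-END STEP.** Under the cycle invariant (admissible functional oracle,
`ν ≠ Φ^{(N)}`), at a canonical near step `X_n ← X_{n+1}` leading to a state between cycles (`P = none`, so the centre is the
whole treated part `Y_n^{(j)}`, `j` the treated label), a MOVING BIRTH `Z' ∋ x_{n+1}` has its image closure `B = closure f(Z')`
inside ONE irreducible component `S ∋ x_n` of `X_n(ν)` OF LABEL `j` (births lie over the centre; an irreducible set inside the
finite union `Y^{(j)}` of closed components lies in one of them), with `{x_n} ⊊ B ⊊ S`: the host `S` has depth `≥ 2` at `x_n`.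
[cite: CossartJannsenSaito2020, Rem. 6.29 (1), p. 92] -/
theorem IsMovingBirthAt.exists_host {k : Type u} [Field k] (hRf : OracleFunctional R) (hRa : OracleAdmissible R)
    (hν : ν ≠ iterPSum N Phi) {s s' : MarkedStage.{u}} (h : CycleInv k R N ν s) (hst : CanonicalNearStep R N ν s s')
    (hnone : s'.P = none) {f : s'.W ⟶ s.W} (hf : StepProjection R N ν s s' f) {Z' : Set s'.W}
    (hZ' : IsMovingBirthAt N ν s s' f Z') :
    ∃ S ∈ componentsThrough N ν s, s.L.label S = treatedLabel N ν s ∧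
      (∀ (C : s.W.IdealSheafData) (P' : Option (Pending (blowup C))), IsCanonicalStep R N ν s.L s.P C P' →
        S ⊆ (C.support : Set s.W)) ∧
      closure (f.base '' Z') ⊆ S ∧ closure (f.base '' Z') ≠ S ∧ HasSandwichAt s S := by
  obtain ⟨⟨hZ'c, hnot⟩, hne⟩ := hZ'
  haveI := s.ln
  haveI : IsNoetherian s.W := h.isNoetherian
  -- births lie over the centre
  obtain ⟨C, P', hcs, hsub⟩ := hf.subset_preimage_support_of_not_mem hRa hν h hZ'c.1 hnot
  have hsupp : (C.support : Set s.W) = s.L.part (Scheme.hsStratum s.W N ν) (treatedLabel N ν s) :=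
    support_eq_part_of_next_none hRf hst hnone hcs
  -- the image closure `B`
  set B : Set s.W := closure (f.base '' Z') with hB
  have hBirr : IsIrreducible B :=
    ((componentsIn.isIrreducible hZ'c.1).image _ f.base.hom.continuous.continuousOn).closure
  have hBC : B ⊆ (C.support : Set s.W) :=
    closure_minimal (Set.image_subset_iff.mpr hsub) C.support.isClosed
  have hxB : s.pt ∈ B := subset_closure ⟨s'.pt, hZ'c.2, hf.base_pt⟩
  -- `B` lies in ONE label-`j` component `S`
  have hY : IsClosed (Scheme.hsStratum s.W N ν) := h.isClosed_hsStratum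
  let 𝒮 : Set (Set s.W) := {Z | Z ∈ componentsIn (Scheme.hsStratum s.W N ν) ∧ s.L.label Z = treatedLabel N ν s}
  have h𝒮fin : 𝒮.Finite := (componentsIn.finite _).subset fun _ hZ => hZ.1
  have hBcov : B ⊆ ⋃₀ (h𝒮fin.toFinset : Set (Set s.W)) := by
    intro b hb
    have hb' : b ∈ s.L.part (Scheme.hsStratum s.W N ν) (treatedLabel N ν s) := hsupp ▸ hBC hb
    obtain ⟨Z, hZ, hl, hbZ⟩ := (s.L.mem_part_iff _ _ _).mp hb'
    exact ⟨Z, h𝒮fin.mem_toFinset.mpr ⟨hZ, hl⟩, hbZ⟩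
  obtain ⟨S, hS, hBS⟩ := isIrreducible_iff_sUnion_isClosed.mp hBirr h𝒮fin.toFinset
    (fun Z hZ => componentsIn.isClosed hY (h𝒮fin.mem_toFinset.mp hZ).1) hBcov
  obtain ⟨hSc, hSl⟩ := h𝒮fin.mem_toFinset.mp hS
  have hxS : s.pt ∈ S := hBS hxB
  have hBneS : B ≠ S := fun hBS' => hnot (hBS' ▸ hSc)
  refine ⟨S, ⟨hSc, hxS⟩, hSl, fun C₁ P₁ hcs₁ => ?_, hBS, hBneS,
    ⟨B, hBirr, isClosed_closure, hxB, hBS, hne, hBneS⟩⟩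
  obtain rfl : C₁ = C := hcs₁.centre_unique hRf hcs
  rw [hsupp]
  exact s.L.subset_part hSc hSl

/-- **NO MOVING BIRTH OVER A CENTRE COMPONENT OF DEPTH ≤ 1 («curve germ»)**: under the cycle invariant, at a blown-up cycle-end
step at which NO label-`j` component of `X_n(ν)` through `x_n` (`j` the treated label — these are the components of the centre
through `x_n`) has depth `≥ 2` at `x_n`, there is no moving birth through `x_{n+1}` (plan-1 RULINGS v3.12-1 (C) / v3.12-2 (J1):
«irreducible curve germ ⇒ no moving birth», PROVED; nothing geometric is assumed). [cite: CossartJannsenSaito2020, Rem. 6.29 (1), p. 92] -/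
theorem not_isMovingBirthAt_of_forall_not_hasSandwichAt {k : Type u} [Field k] (hRf : OracleFunctional R)
    (hRa : OracleAdmissible R) (hν : ν ≠ iterPSum N Phi) {s s' : MarkedStage.{u}} (h : CycleInv k R N ν s)
    (hst : CanonicalNearStep R N ν s s') (hnone : s'.P = none) {f : s'.W ⟶ s.W} (hf : StepProjection R N ν s s' f)
    (hcurve : ∀ S ∈ componentsThrough N ν s, s.L.label S = treatedLabel N ν s → ¬ HasSandwichAt s S) (Z' : Set s'.W) :
    ¬ IsMovingBirthAt N ν s s' f Z' := by
  intro hZ'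
  obtain ⟨S, hS, hSl, -, -, -, hsand⟩ := hZ'.exists_host hRf hRa hν h hst hnone hf
  exact hcurve S hS hSl hsand

/-! ## §2. The two rows of the reduction: NO LATE DEPTH JUMPS (the ruled REBIRTH twin of `NoRuledBirth3`, OPEN) and the DEPTH
DISCIPLINE of permissible blow-ups in dimension ≤ 3 (standard geometry, typed as one campaign statement) -/

/-- [OURS · L1 W4.2] **ROW (b-jump) — NO LATE DEPTH JUMPS ALONG DOMINATIONS AT BLOWN-UP CYCLE-END STEPS** (same scope and shape as
`StrataCycleEndBirthsSettle`): along every moving, never-isolated `G`-chain from a `Q`-maximal origin, from some stage on, at a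
blown-up cycle-end step, an irreducible component `Z' ∋ x_{n+1}` of `X_{n+1}(ν)` which DOMINATES a component `Z = closure f(Z')`
of `X_n(ν)` lying INSIDE THE CENTRE and has depth `≥ 2` at `x_{n+1}` dominates a component of depth `≥ 2` at `x_n` — a CURVE
component of the centre is not REBORN through the chain point as a SURFACE. Intended proof (`N = 3`, `G = (3 ≤ ē)`): a
dominating `Z' ⊆ π⁻¹(Z)` over the curve `Z` inside the permissible centre is either finite over `Z` (a curve) or the whole ruled
surface `π⁻¹(Z) = ℙ(C_Z X_n) → Z` (fibres `ℙ(C_{x}(X_n)/T_{x}Z) ≅ ℙ¹`), in which case the fibre `ℙ(Dir_{x_n}/T_{x_n}Z) ≅ ℙ¹` over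
`x_n` lies WHOLLY inside `X_{n+1}(ν)` — the RULED phenomenon of res-type-067's `NoRuledBirth3` / `¬ RuledBirthDatumD`
(`…StrataBirthsTopDictionaryGraded`), read for a dominating instead of a newborn component; so the graded exclusion «`ℙ¹` over
`x_n` not wholly near, eventually, at curve-centre cycle ends» proves this row as well. Why it might fail: a RULED RECURRENCE
(the whole `ℙ¹` near again and again along curve-centred cycle ends) — kill criterion k17 of the chain. OURS row, OPEN
(K3d-frontier class, same status as `NoRuledBirth3`); NOT a statement of the manuscript. [cite: CossartJannsenSaito2020, Thm. 3.14, Rem. 6.29 (1)] -/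
def StrataCycleEndNoDepthJumps (p N : ℕ) (Q : ℕ → (ℕ → ℕ) → ∀ X : Scheme.{u}, X → Prop) (G : MarkedStage.{u} → Prop) : Prop :=
  ∀ (R : ∀ S : Scheme.{u}, CentreSeq S → Prop), OracleFunctional R → OracleAdmissible R →
  ∀ (ν : ℕ → ℕ) (X : Scheme.{u}) [IsLocallyNoetherian X] (x : X), IsMaximalOrigin p N ν X x → Q N ν X x →
  ∀ c : ℕ → MarkedStage.{u}, Reaches R N ν (MarkedStage.init X x) (c 0) →
    (∀ n, CanonicalNearStep R N ν (c n) (c (n + 1))) → (∀ n, G (c n)) → (∀ n, ¬ Iso N (c n)) →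
    (∀ n, ∃ m, n ≤ m ∧ (c m).IsBlownUp R N ν) →
    ∃ n₁, ∀ n, n₁ ≤ n → (c n).IsBlownUp R N ν → (c (n + 1)).P = none →
      ∀ f : (c (n + 1)).W ⟶ (c n).W, StepProjection R N ν (c n) (c (n + 1)) f →
        ∀ Z' ∈ componentsThrough N ν (c (n + 1)),
          closure (f.base '' Z') ∈ componentsIn (Scheme.hsStratum (c n).W N ν) →
          (∃ (C : (c n).W.IdealSheafData) (P' : Option (Pending (blowup C))),
              IsCanonicalStep R N ν (c n).L (c n).P C P' ∧ closure (f.base '' Z') ⊆ (C.support : Set (c n).W)) →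
          HasSandwichAt (c (n + 1)) Z' → HasSandwichAt (c n) (closure (f.base '' Z'))

/-- [OURS · L1 W4.2] **STRATA DEPTH DISCIPLINE — standard geometry of permissible blow-ups in dimension `≤ 3`, typed as ONE
campaign statement (like `GeomDirDimNonincrease`; NOT eventual, NOT open in substance).** Along every chain from a `Q`-maximal
origin (same binders as the rows; the grade, isolation and moving hypotheses are carried only for uniformity), at every step
`X_n ← X_{n+1}` read through its step projection `f`:
(a) at a cycle-end step (`(c (n+1)).P = none`) a MOVING-BIRTH newborn `Z' ∋ x_{n+1}` has depth `≤ 1` at `x_{n+1}` («moving births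
are CURVES»: `Z'` lies in the exceptional divisor over the curve `B = closure f(Z')` inside the host surface `S` of the permissible
centre (`IsMovingBirthAt.exists_host`), and `π⁻¹(S) → S` has zero-dimensional fibres — `X_n` is normally flat along `S`, of
codimension `1` in the component of `X_n` through it; so no irreducible closed `B' ∋ x_{n+1}` sits strictly between `{x_{n+1}}`
and `Z'`);
(b) a DOMINATING component gains depth only inside the centre («strict transforms of curves are curves»: if
`Z = closure f(Z') ⊄ V(C)` then `Z'` is the strict transform of `Z`, an isomorphism over `Z ∖ V(C)`, with finitely many closed points
over `x_n`; so `Z'` has depth `≥ 2` at `x_{n+1}` only if `Z` does at `x_n`, unless `Z ⊆ V(C)`).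
BELIEVED AND CONSUMED AT LEVEL `N = 3` ONLY (`dim X_n ≤ 3`: clause (a) uses that the host surface has codimension `1`; for larger
`N` the def is a mere `Prop`-valued function and is NOT claimed). Dischargeable from the tree's blow-up / dimension library (M);
taken as a binder by D13. OURS campaign statement; NOT a statement of the manuscript.
[cite: CossartJannsenSaito2020, Def. 3.1, Thm. 3.14] [cite: GortzWedhorn2020, Prop. 13.91 (3)] -/
def StrataDepthDiscipline (p N : ℕ) (Q : ℕ → (ℕ → ℕ) → ∀ X : Scheme.{u}, X → Prop) (G : MarkedStage.{u} → Prop) : Prop :=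
  ∀ (R : ∀ S : Scheme.{u}, CentreSeq S → Prop), OracleFunctional R → OracleAdmissible R →
  ∀ (ν : ℕ → ℕ) (X : Scheme.{u}) [IsLocallyNoetherian X] (x : X), IsMaximalOrigin p N ν X x → Q N ν X x →
  ∀ c : ℕ → MarkedStage.{u}, Reaches R N ν (MarkedStage.init X x) (c 0) →
    (∀ n, CanonicalNearStep R N ν (c n) (c (n + 1))) → (∀ n, G (c n)) → (∀ n, ¬ Iso N (c n)) →
    (∀ n, ∃ m, n ≤ m ∧ (c m).IsBlownUp R N ν) →
    ∀ n (f : (c (n + 1)).W ⟶ (c n).W), StepProjection R N ν (c n) (c (n + 1)) f →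
      ((c (n + 1)).P = none → ∀ Z', IsMovingBirthAt N ν (c n) (c (n + 1)) f Z' → ¬ HasSandwichAt (c (n + 1)) Z') ∧
      (∀ Z' ∈ componentsThrough N ν (c (n + 1)),
        closure (f.base '' Z') ∈ componentsIn (Scheme.hsStratum (c n).W N ν) →
        HasSandwichAt (c (n + 1)) Z' → ¬ HasSandwichAt (c n) (closure (f.base '' Z')) →
        ∃ (C : (c n).W.IdealSheafData) (P' : Option (Pending (blowup C))),
          IsCanonicalStep R N ν (c n).L (c n).P C P' ∧ closure (f.base '' Z') ⊆ (C.support : Set (c n).W))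

end Summit.ResolutionOfSingularities.ResolutionOfSingularities.Theorems.SigmaMaxModificationsCorridor3.Moving

end
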